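import Summits.QuantumFields.YangMills.Theorems.LuscherReductionTwistedTraceScalingBOStiffCurrencyCut
import Summits.QuantumFields.YangMills.Theorems.LuscherReductionTwistedTraceScalingBOStiffBasedBOKernel
import Summits.QuantumFields.YangMills.Theorems.LuscherReductionTwistedTraceScalingBOStiffCoreCoeff
import HarnessLib

/-!
# (B-ST) step (F) = (L-6), THE CURRENCY OF RECORD: `(λ₀/K₁(1,1))·⟨Θ, G₁Θ⟩/Z̄ ≤ (1 + a)·Λ_rec(β)` for every `a > 0`, eventually in `β`
# (lane A of S-BASE, crux `TwistedTraceScaling` stmt-QuantumFields-20203, C4-CORE, the (B-ST) pen; HANDOFF-g21 UPDATE 20:14Z (W1-5) = (L-6))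

The assembly's core coefficient is `κ₀·Λ_fib` with `κ₀ = λ₀(L³β)/K₁(1,1)` (slow operator bound with the normalised one-site kernel) and `Λ_fib` the fibre quasimode level of the BASED central
kernel `G₁(x,x') = ∫_h K_β(orthoTube 1 x, (orthoTube 1 x')^{basedExt h}) dh` against `Θ = Ω_c∘linkEmbed` in the reference weight `w̄ = softWeight χ∘orthoTube 1`, i.e. `Λ_fib = ⟨Θ,G₁Θ⟩_π/Z̄`
up to (S3)'s `1 + η` (lead), `Z̄ = ∫Θ²w̄ dπ = fibreMass L (softWeight χ) Ω_c 1`.  The target currency is `Λ_rec = (btC/fpZ/γ)·λ₀(L³β)`.  Three landed facts close the comparison: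
(i) the MATCHING IDENTITY `⟨Θ,G₁Θ⟩_π = boKernel β Ω_c 1 1` (✓`…BOStiffBasedBOKernel.boKernel_one_one_eq_based`); (ii) the FP CUT `(λ₀/K₁(1,1))·boKernel(1,1)/γ ≤ (1+a)·Λ_rec`
(✓`…BOStiffCurrencyCut.eventually_boRayleigh_le_recordCurrency`, R65); (iii) the fibre-mass brick `Z̄ ≥ (1 − C_Pδ²)·γ` at `u = 1` (✓`…FibreMassBrick.fibreMass_brick_record`, (P), fibres of the
profile ball in the fat tube ✓`…BOStiffCoreCoeff.eventually_orthoTube_one_mem_fatTube`).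
★★★ `stiff_currency_record` — for `L` with a non-zero site and `0 < s ≤ 1/3`: `∃ M₀ ≥ 2, ∀ M ≥ M₀, ∀ a > 0, ∀ᶠ β`,
  `(λ₀(L³β)/K₁(1,1))·(∫_v Ω_c(v̂)(∫_{v'} G₁(v,v')Ω_c(v̂') dπ) dπ / Z̄) ≤ (1 + a)·Λ_rec(β)`  (`Λ_rec` the literal currency of `recordAnalyticInput_of_hST`).
With the lead's `Λ_fib ≤ (1+η)·⟨Θ,G₁Θ⟩/Z̄` this is `κ₀·Λ_fib ≤ (1+η)(1+a)·Λ_rec`, the (L-6) input of `…BOStiffCurrencyAlg.stiff_core_budget` / `…BOStiffAssembly.pieces_budget`.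
HONEST FRAMING: bookkeeping for a stub of a child of the CONDITIONAL route R2b1; (B-ST) OPEN ((S3) and the final assembly are the lead's); C4-CORE OPEN; not infinite volume, not a gap, not Clay.
-/

set_option autoImplicit false

noncomputable section

open MeasureTheory Filter Topology Real
open scoped BigOperators
open Literature.MathematicalPhysics.QuantumFieldTheory
open Literature.MathematicalPhysics.QuantumLattice

namespace Summit.QuantumFields.YangMills.Theorems.FemtoTransferGap.TwoLattice.ConstTube

open Summit.QuantumFields.YangMills.Theorems.FemtoTransferGap
open Summit.QuantumFields.YangMills.Theorems.FemtoTransferGap.TwoLattice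
open Summit.QuantumFields.YangMills.Theorems.FemtoTransferGap.TwoLattice.Avg
open Summit.QuantumFields.YangMills.Theorems.FemtoTransferGap.TwoLattice.Stiff
open Summit.QuantumFields.YangMills.Theorems.FemtoTransferGap.TwoLattice.GnChart
open Summit.QuantumFields.YangMills.Theorems.FemtoTransferGap.TwoLattice.Cov
open Summit.QuantumFields.YangMills.Theorems.TwistedTraceScaling.Negative

variable {L : ℕ} [NeZero L]

set_option maxHeartbeats 1600000 in
-- long record expressions.
/-- ★★★ **THE (B-ST) CURRENCY OF RECORD** (see the module docstring). [cite: Luscher1983, §3] [cite: SeilerLNP1982, §3] -/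
theorem stiff_currency_record (hLz : Nonempty (NzSite L)) {s : ℝ} (hs : 0 < s) (hs3 : s ≤ 1 / 3) :
    ∃ M₀ : ℝ, 2 ≤ M₀ ∧ ∀ M : ℝ, M₀ ≤ M → ∀ a : ℝ, 0 < a → ∀ᶠ β : ℝ in atTop,
      levelValue su2Rep 1 ((L : ℝ) ^ 3 * β) 0 / transferKernel su2Rep ((L : ℝ) ^ 3 * β) (1 : GaugeConfig 3 1 SU2) 1 *
          ((∫ v, ({x : LinkSpace L | linkCurry x ∈ capBalancedSet L}.indicator (fun _ => (1 : ℝ)) (linkEmbed L v) *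
                  frozenProfile L (fun β' => stiffGaussExp L (β' / 2) β') (fun β' => min (1 / 40) (powScale (1 / 2) β' * btLog β')) β (linkEmbed L v)) *
                (∫ v', (∫ h, transferKernel su2Rep β (orthoTube L 1 v) (gaugeTransform (basedExt L h) (orthoTube L 1 v')) ∂basedMeasure L) *
                  ({x : LinkSpace L | linkCurry x ∈ capBalancedSet L}.indicator (fun _ => (1 : ℝ)) (linkEmbed L v') *
                    frozenProfile L (fun β' => stiffGaussExp L (β' / 2) β') (fun β' => min (1 / 40) (powScale (1 / 2) β' * btLog β')) β (linkEmbed L v')) ∂orthoTransverse L)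
              ∂orthoTransverse L) /
            fibreMass L (softWeight (recordChi L s 43 M β)) (fun x : LinkSpace L => {x : LinkSpace L | linkCurry x ∈ capBalancedSet L}.indicator (fun _ => (1 : ℝ)) x *
              frozenProfile L (fun β' => stiffGaussExp L (β' / 2) β') (fun β' => min (1 / 40) (powScale (1 / 2) β' * btLog β')) β x) 1) ≤
        (1 + a) * (btC L β (fun x : LinkSpace L => {x : LinkSpace L | linkCurry x ∈ capBalancedSet L}.indicator (fun _ => (1 : ℝ)) x * frozenProfile L (fun β' => stiffGaussExp L (β' / 2) β') (fun β' => min (1 / 40) (powScale (1 / 2) β' * btLog β')) β x) (btEps β) (5 * (powScale (1 / 2) β * btLog β ^ 2)) / fpZ (btEps β) / recordGamma L (fun β' => fun x : LinkSpace L => {x : LinkSpace L | linkCurry x ∈ capBalancedSet L}.indicator (fun _ => (1 : ℝ)) x * frozenProfile L (fun β'' => stiffGaussExp L (β'' / 2) β'') (fun β'' => min (1 / 40) (powScale (1 / 2) β'' * btLog β'')) β' x) β *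
          levelValue su2Rep 1 ((L : ℝ) ^ 3 * β) 0) := by
  -- (P) for the fibre-mass brick at `u = 1`
  have hδ0 : ∀ β, 0 < 43 * powScale s β := fun β => mul_pos (by norm_num) (powScale_pos s β)
  have hδ : Tendsto (fun β => 43 * powScale s β) atTop (𝓝 0) := by simpa using (tendsto_powScale hs).const_mul 43
  have hsd1 : ∀ᶠ β in atTop, 0 < powScale 1 β ∧ powScale 1 β ≤ (43 * powScale s β) ^ 3 := by
    filter_upwards [eventually_ge_atTop (1 : ℝ)] with β hβ
    have hp := powScale_pos 1 β
    have h1 : powScale 1 β ≤ powScale s β ^ 3 := powScale_one_le_cube hs3 hβ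
    have hps0 : 0 ≤ powScale s β ^ 3 := pow_nonneg (powScale_pos s β).le 3
    refine ⟨hp, h1.trans ?_⟩
    calc powScale s β ^ 3 = 1 * powScale s β ^ 3 := (one_mul _).symm
      _ ≤ 43 ^ 3 * powScale s β ^ 3 := mul_le_mul_of_nonneg_right (by norm_num) hps0
      _ = (43 * powScale s β) ^ 3 := by ring
  obtain ⟨M₀, hM₀, H⟩ := fpWeight_core_constant L hLz hδ0 hδ hsd1
  refine ⟨M₀, hM₀, fun M hM a ha => ?_⟩
  obtain ⟨C, β₀, hC, hP⟩ := H M hM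
  have hM2 : 2 ≤ M := hM₀.trans hM
  have hδ2 : Tendsto (fun β => (43 * powScale s β) ^ 2) atTop (𝓝 0) := by simpa using hδ.pow 2
  have ha3 : 0 < a / 3 := by positivity
  have hκa : (0 : ℝ) < a / (3 * (1 + a)) := by positivity
  obtain ⟨cΛ, KΛ, hcΛ, hΛev⟩ := recordLambda_floor (L := L)
  filter_upwards [eventually_ge_atTop β₀, eventually_mul_le_of_tendsto hδ2 C (by norm_num : (0 : ℝ) < 1 / 2), eventually_mul_le_of_tendsto hδ2 C hκa,
    eventually_boRayleigh_le_recordCurrency (L := L) ha3, eventually_orthoTube_one_mem_fatTube (L := L) hs (by linarith) hM2, eventually_ge_atTop (0 : ℝ), hΛev]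
    with β hβ0 hκ1 hκ2 hcur hgeo hβ hΛfloor
  -- names
  set Ω : LinkSpace L → ℝ := fun x => {x : LinkSpace L | linkCurry x ∈ capBalancedSet L}.indicator (fun _ => (1 : ℝ)) x *
    frozenProfile L (fun β' => stiffGaussExp L (β' / 2) β') (fun β' => min (1 / 40) (powScale (1 / 2) β' * btLog β')) β x with hΩdef
  set κ₀ : ℝ := levelValue su2Rep 1 ((L : ℝ) ^ 3 * β) 0 / transferKernel su2Rep ((L : ℝ) ^ 3 * β) (1 : GaugeConfig 3 1 SU2) 1 with hκ₀
  set γ : ℝ := recordGamma L (fun β' => fun x : LinkSpace L => {x : LinkSpace L | linkCurry x ∈ capBalancedSet L}.indicator (fun _ => (1 : ℝ)) x *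
      frozenProfile L (fun β'' => stiffGaussExp L (β'' / 2) β'') (fun β'' => min (1 / 40) (powScale (1 / 2) β'' * btLog β'')) β' x) β with hγ
  set Λ : ℝ := btC L β Ω (btEps β) (5 * (powScale (1 / 2) β * btLog β ^ 2)) / fpZ (btEps β) / γ * levelValue su2Rep 1 ((L : ℝ) ^ 3 * β) 0 with hΛ
  set Z : ℝ := fibreMass L (softWeight (recordChi L s 43 M β)) Ω 1 with hZ
  set κ : ℝ := C * (43 * powScale s β) ^ 2 with hκdef
  have hκ0 : 0 ≤ κ := by positivity
  -- structural fields of the profile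
  have hqf0 : ∀ β' x, 0 ≤ (fun β'' : ℝ => stiffGaussExp L (β'' / 2) β'') β' x := fun β' x => stiffGaussExp_nonneg _ _ x
  have hqinv : ∀ β' (g : SU2) (x : LinkSpace L), (fun β'' : ℝ => stiffGaussExp L (β'' / 2) β'') β' (adL L g x) = (fun β'' : ℝ => stiffGaussExp L (β'' / 2) β'') β' x :=
    fun β' g x => stiffGaussExp_adL _ _ g x
  have hΩGm : Measurable (frozenProfile L (fun β' => stiffGaussExp L (β' / 2) β') (fun β' => min (1 / 40) (powScale (1 / 2) β' * btLog β')) β) :=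
    measurable_frozenProfile (fun β' => measurable_stiffGaussExp _ _) _ β
  have hΩG0 : ∀ x, 0 ≤ frozenProfile L (fun β' => stiffGaussExp L (β' / 2) β') (fun β' => min (1 / 40) (powScale (1 / 2) β' * btLog β')) β x :=
    fun x => (frozenProfile_mem_Icc hqf0 _ β x).1
  have hΩG1 : ∀ x, |frozenProfile L (fun β' => stiffGaussExp L (β' / 2) β') (fun β' => min (1 / 40) (powScale (1 / 2) β' * btLog β')) β x| ≤ 1 :=
    abs_frozenProfile_le hqf0 _ β
  have hΩm : Measurable Ω := measurable_capRestrict (L := L) hΩGm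
  have hΩ1 : ∀ x, |Ω x| ≤ 1 := fun x => (capRestrict_mem (L := L) hΩG0 hΩG1 x).2.2
  have hΩinv : ∀ (g : SU2) (x : LinkSpace L), Ω (adL L g x) = Ω x := fun g x => capRestrict_adL (L := L) (fun g' x' => frozenProfile_adL hqinv _ β g' x') g x
  have hΩR : ∀ x, Ω x ≠ 0 → ‖x‖ ≤ min (1 / 40) (powScale (1 / 2) β * btLog β) := fun x hx => norm_le_of_frozenProfile_ne_zero _ _ β (right_ne_zero_of_mul hx)
  -- (i) the matching identity
  have hid := boKernel_one_one_eq_based (L := L) β hΩm hΩ1 hΩinv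
  rw [← hid]
  -- (iii) `Z ≥ (1−κ)γ`
  have hP' : ∀ U ∈ fatTubeRho L (fun β : ℝ => 43 * powScale s β) (fun b => M * (43 * powScale s b)) β,
      fpWeightBar L (powScale 1 β) * (1 - κ) ≤ gaugeAvg (recordWeightRho L (fun β : ℝ => 43 * powScale s β) (fun b => M * (43 * powScale s b)) (powScale 1) β) U ∧
      gaugeAvg (recordWeightRho L (fun β : ℝ => 43 * powScale s β) (fun b => M * (43 * powScale s b)) (powScale 1) β) U ≤ fpWeightBar L (powScale 1 β) * (1 + κ) :=
    fun U hU => hP β hβ0 U hU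
  have hb := fibreMass_brick_record (L := L) (fun β : ℝ => 43 * powScale s β) (fun b => M * (43 * powScale s b)) (powScale 1) β hP' hΩm hΩ1 hΩR
    (u := 1) (fun x _ hx => hgeo x hx)
  have hbZ : |Z - γ| ≤ κ * γ := hb
  have hγ0 : 0 < γ := by rw [hγ]; exact recordGamma_record_pos (L := L) hβ
  have hZlo : (1 - κ) * γ ≤ Z := by have h1 := (abs_le.mp hbZ).1; linarith
  have hZ0 : 0 < Z := lt_of_lt_of_le (by nlinarith) hZlo
  -- (ii) the cut: `κ₀·𝒦/γ ≤ (1 + a/3)Λ`; also `𝒦 ≥ 0`, `Λ ≥ 0`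
  have hcur' : κ₀ * (boKernel L β Ω 1 1 / γ) ≤ (1 + a / 3) * Λ := hcur
  have hK0 : 0 < transferKernel su2Rep ((L : ℝ) ^ 3 * β) (1 : GaugeConfig 3 1 SU2) 1 := transferKernel_pos _ _ _ _
  have hκ₀0 : 0 ≤ κ₀ := div_nonneg (levelValue_zero_su2Rep_pos 1 ((L : ℝ) ^ 3 * β)).le hK0.le
  have hbo0 : 0 ≤ boKernel L β Ω 1 1 := by
    -- `fpZ·𝒦 = btC·K₁ + cut ≥ 0`
    have hsplit := R65.btC_mul_oneSite_add_tail (L := L) β (btEps β) (5 * (powScale (1 / 2) β * btLog β ^ 2)) hΩm hΩ1 hΩinv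
    have hZp : 0 < fpZ (btEps β) := fpZ_pos (by unfold btEps; exact powScale_pos 1 β)
    have hcut0 : 0 ≤ fpBOKernel L β Ω (tailWeight L (btEps β) (5 * (powScale (1 / 2) β * btLog β ^ 2))) 1 1 :=
      fpBOKernel_nonneg β hΩm hΩ1 (fun x => (capRestrict_mem (L := L) hΩG0 hΩG1 x).1) (measurable_tailWeight _ _) (abs_tailWeight_le _ _) (fun g => (tailWeight_mem_Icc _ _ g).1) 1 1
    have hC0 : 0 ≤ btC L β Ω (btEps β) (5 * (powScale (1 / 2) β * btLog β ^ 2)) := by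
      unfold btC
      exact div_nonneg (fpBOKernel_nonneg β hΩm hΩ1 (fun x => (capRestrict_mem (L := L) hΩG0 hΩG1 x).1) (measurable_coreWeight _ _) (abs_coreWeight_le _ _)
        (fun g => (coreWeight_mem_Icc _ _ g).1) 1 1) hK0.le
    have : 0 ≤ fpZ (btEps β) * boKernel L β Ω 1 1 := by rw [← hsplit]; positivity
    exact (mul_nonneg_iff_of_pos_left hZp).mp this
  have hΛ0 : 0 ≤ Λ := le_trans (mul_pos (mul_pos hcΛ (pow_pos (powScale_pos 1 β) _)) (pow_pos (Real.exp_pos _) _)).le hΛfloor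
  -- assemble: `κ₀·𝒦/Z ≤ κ₀·𝒦/((1−κ)γ) ≤ (1+a/3)/(1−κ)·Λ ≤ (1+a)Λ`
  have h1 : κ₀ * (boKernel L β Ω 1 1 / Z) ≤ κ₀ * (boKernel L β Ω 1 1 / ((1 - κ) * γ)) := by
    refine mul_le_mul_of_nonneg_left (div_le_div_of_nonneg_left hbo0 (by nlinarith) hZlo) hκ₀0
  have h2 : κ₀ * (boKernel L β Ω 1 1 / ((1 - κ) * γ)) = (κ₀ * (boKernel L β Ω 1 1 / γ)) / (1 - κ) := by
    field_simp
  have h3 : (κ₀ * (boKernel L β Ω 1 1 / γ)) / (1 - κ) ≤ (1 + a / 3) * Λ / (1 - κ) := div_le_div_of_nonneg_right hcur' (by linarith)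
  have h4 : (1 + a / 3) * Λ / (1 - κ) ≤ (1 + a) * Λ := by
    rw [div_le_iff₀ (by linarith)]
    -- `(1 + a/3) ≤ (1 + a)(1 − κ)` since `κ(1+a) ≤ a/3·2`... precisely `κ ≤ a/(3(1+a))`
    have hk : κ * (1 + a) ≤ a / 3 := by
      have := hκ2; rw [hκdef] at this ⊢
      have h := (le_div_iff₀ (by positivity : (0 : ℝ) < 3 * (1 + a))).mp this
      nlinarith
    nlinarith
  calc κ₀ * (boKernel L β Ω 1 1 / Z) ≤ κ₀ * (boKernel L β Ω 1 1 / ((1 - κ) * γ)) := h1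
    _ = (κ₀ * (boKernel L β Ω 1 1 / γ)) / (1 - κ) := h2
    _ ≤ (1 + a / 3) * Λ / (1 - κ) := h3
    _ ≤ (1 + a) * Λ := h4

end Summit.QuantumFields.YangMills.Theorems.FemtoTransferGap.TwoLattice.ConstTube

end
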